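import Literature.NumberTheory.GaloisRepresentations.SymplecticMultiplier
import HarnessLib

/-!
# Symplectic framed Galois representations: self-duality up to the multiplier, and the determinant

Proved API for the accepted `FramedGaloisRep.IsSymplecticWithMultiplierFun`
(`Literature/NumberTheory/GaloisRepresentations/SymplecticMultiplier.lean`; Boxer–Calegari–Gee–Pilloni
2021, §2: `ρ : G_ℚ → GSp₄` with similitude `ν`).

* `FramedGaloisRep.IsSymplecticWithMultiplierFun.exists_conj_eq_smul_dual`: if `ρ(g)ᵀ J ρ(g) = ν(g) J`
  with `det J` a unit, then in the frame `J` the representation is its own dual twisted by the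
  multiplier, `J ρ(g) J⁻¹ = ν(g) · ρ(g)⁻ᵀ`, i.e. `ρ ≅ ρ^∨ ⊗ ν` as framed representations (tree
  `FramedRep.conj`, `FramedRep.dual`).  For `ν = ε^{1-n}` this is the (conjugate) self-duality
  `ρ ≅ ρ^∨ ε^{1-n}` assumed by unitary-type automorphy lifting theorems (e.g. Allen–Newton–Thorne
  2020, Thm 1.1, first hypothesis) for a symplectic `ρ` over `ℚ` restricted to a CM field.
* `FramedGaloisRep.IsSymplecticWithMultiplierFun.det_sq`: `det ρ(g)² = ν(g)ⁿ` (any rank, any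
  commutative coefficient ring).
* `FramedGaloisRep.IsSymplecticWithMultiplierFun.det_eq_sq`: in rank `4`, when the Gram matrix has
  zero diagonal (automatic from `Jᵀ = -J` as soon as `2` is a non-zero-divisor,
  `det_eq_sq_of_two_ne_zero`), `det ρ(g) = ν(g)²` — the similitude determines the determinant
  (`GSp₄`: `det = sim²`), via the `4 × 4` Pfaffian identities `Pf(Nᵀ J N) = det N · Pf J` and
  `Pf(J)² = det J` (Artin, *Geometric Algebra*, Thm 3.28; Bourbaki, *Algèbre* IX §5 no. 2).

Mathlib has no Pfaffian (grep `Pfaffian`, `pfaff` in `Mathlib/LinearAlgebra`); the rank-4 Pfaffian is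
written out as the private polynomial identities `pf4_transpose_mul_mul`, `pf4_sq` (not exported).
-/

namespace Literature.NumberTheory.GaloisRepresentations

open Field Matrix

universe u v

variable {K : Type u} [Field K] {A : Type v} [CommRing A] [TopologicalSpace A] {n : ℕ}

/-- **Symplectic ⇒ self-dual up to the multiplier.**  If `ρ(g)ᵀ J ρ(g) = ν(g) J` for all `g` with
`det J ∈ Aˣ`, then for the frame `P = J` one has `P ρ(g) P⁻¹ = ν(g) · (ρ(g)⁻¹)ᵀ`, i.e.
`FramedRep.conj P ρ = ν ⊗ FramedRep.dual ρ` entrywise. [cite: BoxerEtAl2021, §2] -/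
theorem FramedGaloisRep.IsSymplecticWithMultiplierFun.exists_conj_eq_smul_dual [IsTopologicalRing A]
    {ρ : FramedGaloisRep K A n} {ν : absoluteGaloisGroup K → A}
    (h : ρ.IsSymplecticWithMultiplierFun ν) :
    ∃ P : GL (Fin n) A, ∀ g : absoluteGaloisGroup K,
      ((FramedRep.conj P ρ g : GL (Fin n) A) : Matrix (Fin n) (Fin n) A) =
        ν g • ((FramedRep.dual ρ g : GL (Fin n) A) : Matrix (Fin n) (Fin n) A) := by
  obtain ⟨J, -, hJdet, hJ⟩ := h
  have hJu : IsUnit J := (Matrix.isUnit_iff_isUnit_det J).mpr hJdet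
  refine ⟨hJu.unit, fun g => ?_⟩
  set M : Matrix (Fin n) (Fin n) A := ((ρ g : GL (Fin n) A) : Matrix (Fin n) (Fin n) A) with hM
  have hMdet : IsUnit M.det :=
    (Matrix.isUnit_iff_isUnit_det M).mp ((ρ g : GL (Fin n) A).isUnit)
  have hMTdet : IsUnit Mᵀ.det := by rwa [Matrix.det_transpose]
  have h1 : J * M = ν g • ((M⁻¹)ᵀ * J) := by
    calc J * M = (Mᵀ)⁻¹ * Mᵀ * J * M := by rw [Matrix.nonsing_inv_mul _ hMTdet, Matrix.one_mul]
      _ = (Mᵀ)⁻¹ * (Mᵀ * J * M) := by simp only [Matrix.mul_assoc]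
      _ = ν g • ((M⁻¹)ᵀ * J) := by rw [hJ g, Matrix.mul_smul, Matrix.transpose_nonsing_inv]
  have h2 : J * M * J⁻¹ = ν g • (M⁻¹)ᵀ := by
    rw [h1, Matrix.smul_mul, Matrix.mul_assoc, Matrix.mul_nonsing_inv _ hJdet, Matrix.mul_one]
  rw [FramedRep.conj_apply, FramedRep.coe_dual_apply, Units.val_mul, Units.val_mul,
    Matrix.coe_units_inv, Matrix.coe_units_inv, IsUnit.unit_spec]
  exact h2

/-- **`det ρ(g)² = ν(g)ⁿ`** for a rank-`n` representation symplectic with multiplier `ν` (take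
determinants in `ρ(g)ᵀ J ρ(g) = ν(g) J` and cancel the unit `det J`). [cite: BoxerEtAl2021, §2] -/
theorem FramedGaloisRep.IsSymplecticWithMultiplierFun.det_sq
    {ρ : FramedGaloisRep K A n} {ν : absoluteGaloisGroup K → A}
    (h : ρ.IsSymplecticWithMultiplierFun ν) (g : absoluteGaloisGroup K) :
    ((ρ g : GL (Fin n) A) : Matrix (Fin n) (Fin n) A).det ^ 2 = ν g ^ n := by
  obtain ⟨J, -, hJdet, hJ⟩ := h
  have := congrArg Matrix.det (hJ g)
  rw [Matrix.det_mul, Matrix.det_mul, Matrix.det_transpose, Matrix.det_smul, Fintype.card_fin] at this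
  rw [← hJdet.mul_left_inj, ← this]
  ring

/-! ### Rank 4: the Pfaffian and `det = ν²` -/

section RankFour

variable {R : Type*} [CommRing R]

/-- Cofactor expansion of a `4 × 4` determinant along the first row. [folklore] -/
private theorem det_fin_four' (N : Matrix (Fin 4) (Fin 4) R) :
    N.det =
      N 0 0 * (N 1 1 * (N 2 2 * N 3 3 - N 2 3 * N 3 2) - N 1 2 * (N 2 1 * N 3 3 - N 2 3 * N 3 1)
          + N 1 3 * (N 2 1 * N 3 2 - N 2 2 * N 3 1))
      - N 0 1 * (N 1 0 * (N 2 2 * N 3 3 - N 2 3 * N 3 2) - N 1 2 * (N 2 0 * N 3 3 - N 2 3 * N 3 0)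
          + N 1 3 * (N 2 0 * N 3 2 - N 2 2 * N 3 0))
      + N 0 2 * (N 1 0 * (N 2 1 * N 3 3 - N 2 3 * N 3 1) - N 1 1 * (N 2 0 * N 3 3 - N 2 3 * N 3 0)
          + N 1 3 * (N 2 0 * N 3 1 - N 2 1 * N 3 0))
      - N 0 3 * (N 1 0 * (N 2 1 * N 3 2 - N 2 2 * N 3 1) - N 1 1 * (N 2 0 * N 3 2 - N 2 2 * N 3 0)
          + N 1 2 * (N 2 0 * N 3 1 - N 2 1 * N 3 0)) := by
  rw [Matrix.det_succ_row_zero]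
  simp [Fin.sum_univ_succ, Matrix.det_fin_three, Matrix.submatrix_apply, Fin.succAbove]
  ring

/-- Entries of `Nᵀ J N` as explicit double sums. [folklore] -/
private theorem transpose_mul_mul_apply (N J : Matrix (Fin 4) (Fin 4) R) (i j : Fin 4) :
    (Nᵀ * J * N) i j = ∑ k, ∑ l, N k i * J k l * N l j := by
  simp only [Matrix.mul_apply, Matrix.transpose_apply, Finset.sum_mul]
  rw [Finset.sum_comm]

set_option maxRecDepth 16384 in
/-- **`Pf(Nᵀ J N) = det N · Pf J`** for an alternating `4 × 4` matrix `J` with zero diagonal, where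
`Pf M = M₀₁M₂₃ − M₀₂M₁₃ + M₀₃M₁₂` is the rank-4 Pfaffian (Artin, *Geometric Algebra*, Thm 3.28).
[folklore] -/
private theorem pf4_transpose_mul_mul (N J : Matrix (Fin 4) (Fin 4) R) (hJ : Jᵀ = -J)
    (hd : ∀ i, J i i = 0) :
    (Nᵀ * J * N) 0 1 * (Nᵀ * J * N) 2 3 - (Nᵀ * J * N) 0 2 * (Nᵀ * J * N) 1 3 +
        (Nᵀ * J * N) 0 3 * (Nᵀ * J * N) 1 2 =
      N.det * (J 0 1 * J 2 3 - J 0 2 * J 1 3 + J 0 3 * J 1 2) := by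
  have ha : ∀ i j, J j i = -J i j := fun i j => by
    have := congrFun (congrFun hJ i) j
    simpa [Matrix.transpose_apply] using this
  have h10 := ha 0 1; have h20 := ha 0 2; have h30 := ha 0 3
  have h21 := ha 1 2; have h31 := ha 1 3; have h32 := ha 2 3
  have h00 := hd 0; have h11 := hd 1; have h22 := hd 2; have h33 := hd 3
  simp only [transpose_mul_mul_apply, Fin.sum_univ_four, det_fin_four', h10, h20, h30, h21, h31,
    h32, h00, h11, h22, h33]
  ring

/-- **`Pf(J)² = det J`** for an alternating `4 × 4` matrix `J` with zero diagonal. [folklore] -/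
private theorem pf4_sq (J : Matrix (Fin 4) (Fin 4) R) (hJ : Jᵀ = -J) (hd : ∀ i, J i i = 0) :
    (J 0 1 * J 2 3 - J 0 2 * J 1 3 + J 0 3 * J 1 2) ^ 2 = J.det := by
  have ha : ∀ i j, J j i = -J i j := fun i j => by
    have := congrFun (congrFun hJ i) j
    simpa [Matrix.transpose_apply] using this
  have h10 := ha 0 1; have h20 := ha 0 2; have h30 := ha 0 3
  have h21 := ha 1 2; have h31 := ha 1 3; have h32 := ha 2 3
  have h00 := hd 0; have h11 := hd 1; have h22 := hd 2; have h33 := hd 3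
  rw [det_fin_four']
  simp only [h10, h20, h30, h21, h31, h32, h00, h11, h22, h33]
  ring

/-- **`GSp₄`: the similitude determines the determinant, `det ρ(g) = ν(g)²`**, for a rank-4
representation symplectic with multiplier `ν` whose Gram matrix can be taken with zero diagonal
(i.e. genuinely alternating; automatic when `2` is a non-zero-divisor, `det_eq_sq_of_two_ne_zero`).
Proof: `det ρ(g) · Pf J = Pf(ρ(g)ᵀ J ρ(g)) = Pf(ν(g) J) = ν(g)² Pf J` and `Pf(J)² = det J ∈ Aˣ`.
[cite: BoxerEtAl2021, §2] -/
theorem FramedGaloisRep.IsSymplecticWithMultiplierFun.det_eq_sq_of_diag_eq_zero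
    {ρ : FramedGaloisRep K A 4} {ν : absoluteGaloisGroup K → A}
    (h : ∃ J : Matrix (Fin 4) (Fin 4) A, Jᵀ = -J ∧ (∀ i, J i i = 0) ∧ IsUnit J.det ∧
      ∀ g : absoluteGaloisGroup K, (ρ g).valᵀ * J * (ρ g).val = ν g • J)
    (g : absoluteGaloisGroup K) :
    ((ρ g : GL (Fin 4) A) : Matrix (Fin 4) (Fin 4) A).det = ν g ^ 2 := by
  obtain ⟨J, hJT, hd, hJdet, hJ⟩ := h
  have hpf : IsUnit (J 0 1 * J 2 3 - J 0 2 * J 1 3 + J 0 3 * J 1 2) := by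
    have h2 : IsUnit ((J 0 1 * J 2 3 - J 0 2 * J 1 3 + J 0 3 * J 1 2) ^ 2) := by
      rw [pf4_sq J hJT hd]; exact hJdet
    exact (isUnit_pow_iff two_ne_zero).mp h2
  have key := pf4_transpose_mul_mul ((ρ g : GL (Fin 4) A) : Matrix (Fin 4) (Fin 4) A) J hJT hd
  rw [hJ g] at key
  simp only [Matrix.smul_apply, smul_eq_mul] at key
  have key' : ν g ^ 2 * (J 0 1 * J 2 3 - J 0 2 * J 1 3 + J 0 3 * J 1 2) =
      ((ρ g : GL (Fin 4) A) : Matrix (Fin 4) (Fin 4) A).det *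
        (J 0 1 * J 2 3 - J 0 2 * J 1 3 + J 0 3 * J 1 2) := by
    rw [← key]; ring
  exact (hpf.mul_left_inj.mp key').symm

/-- **`GSp₄`: `det ρ(g) = ν(g)²`** for a rank-4 representation symplectic with multiplier `ν`
(`IsSymplecticWithMultiplierFun`), over any commutative coefficient ring in which `2` is a
non-zero-divisor (so that `Jᵀ = -J` forces a zero diagonal) — e.g. `ℚ̄_p`, `𝓞`, or a field of
odd characteristic. [cite: BoxerEtAl2021, §2] -/
theorem FramedGaloisRep.IsSymplecticWithMultiplierFun.det_eq_sq_of_two_ne_zero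
    {ρ : FramedGaloisRep K A 4} {ν : absoluteGaloisGroup K → A}
    (h : ρ.IsSymplecticWithMultiplierFun ν) (h2 : IsRegular (2 : A)) (g : absoluteGaloisGroup K) :
    ((ρ g : GL (Fin 4) A) : Matrix (Fin 4) (Fin 4) A).det = ν g ^ 2 := by
  obtain ⟨J, hJT, hJdet, hJ⟩ := h
  refine FramedGaloisRep.IsSymplecticWithMultiplierFun.det_eq_sq_of_diag_eq_zero
    ⟨J, hJT, fun i => ?_, hJdet, hJ⟩ g
  have hi : J i i = -J i i := by
    have := congrFun (congrFun hJT i) i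
    simpa [Matrix.transpose_apply] using this
  have h2J : (2 : A) * J i i = 0 := by rw [two_mul]; nth_rewrite 1 [hi]; rw [neg_add_cancel]
  exact h2.left (by simpa using h2J)

/-- **`GSp₄` over a field of characteristic `≠ 2`: `det ρ(g) = ν(g)²`.** [cite: BoxerEtAl2021, §2] -/
theorem FramedGaloisRep.IsSymplecticWithMultiplierFun.det_eq_sq {L : Type v} [Field L]
    [TopologicalSpace L] [NeZero (2 : L)] {ρ : FramedGaloisRep K L 4} {ν : absoluteGaloisGroup K → L}
    (h : ρ.IsSymplecticWithMultiplierFun ν) (g : absoluteGaloisGroup K) :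
    ((ρ g : GL (Fin 4) L) : Matrix (Fin 4) (Fin 4) L).det = ν g ^ 2 :=
  h.det_eq_sq_of_two_ne_zero (IsRegular.of_ne_zero (NeZero.ne 2)) g

end RankFour

end Literature.NumberTheory.GaloisRepresentations
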